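import Summits.SmoothPoincare4.SmoothPoincare4.Theorems.SullivanDualWitnessChargeCapDefs
import Summits.SmoothPoincare4.SmoothPoincare4.Theorems.SullivanDualWitnessChargeFlatChart
import Summits.SmoothPoincare4.SmoothPoincare4.Theorems.SullivanDualTargetHelperLineEnergyFlat
import Literature.Topology.FourManifolds.GluingConstruction
import Literature.Topology.FourManifolds.GluingConstructionMaps
import Literature.Geometry.Symplectic.JPlanePencilLocalFamily

/-!
# Cap model for crux `WitnessCharge`, I: the gluing datum of the one-chart end cap

Stub `stub_capModel` of skeleton v15 (line `Sketch`, lead c8) asks for `Nonempty (CapData S p J ε')`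
(`Theorems/SullivanDualWitnessChargeCapDefs.lean`). This file builds the underlying smooth
4-manifold: the open gluing (`Literature.Topology.FourManifolds.SmoothGlueData`, Kosinski VI.1)

  `X = (Σ ∖ p) ∪_glue B`,  `B = capDisc ρ = {(t, σ) : ℂ × ℂ | ‖t‖ < ρ}`,
  `glue x = ((z x)⁻¹, w x)` on `{x in the punctured ε'-ball | ρ⁻¹ < ‖z x‖}`,

where `(z, w) = Ycoord p` are the complex flat coordinates of the standard end (the flat chart
`Φ` of `substub_flatChart`) and `ρ = min (ε'/2) 1`. Contents: the cap disc `capDisc`, the inversion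
`invFst` of the first coordinate, the flat chart `flatChart` (chosen from `substub_flatChart`) and
its bookkeeping, the gluing map `capGlue` and datum `capGlueData` (smooth in both directions),
Hausdorffness of the glued space (closed graph) and its second countability (σ-compactness).
The charts, the embedding `ι = inl`, the cap chart and the almost complex structure are in the
sequel files `…V15CapModelCharts.lean`, `…V15CapModelACS.lean`, `…V15CapModel.lean`.
-/

noncomputable section

set_option linter.dupNamespace false

open scoped Manifold ContDiff Topology
open Set Filter Function Literature.Geometry.Symplectic Literature.Topology.FourManifolds
  TopologicalSpace

namespace Summit.SmoothPoincare4.SmoothPoincare4.Theorems.WitnessCharge.PencilIncompleteness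

/-! ### The cap disc and the inversion of the first coordinate -/

/-- The cap disc `{(t, σ) : ℂ × ℂ | ‖t‖ < ρ}` as an open subset of `ℂ × ℂ`. -/
def capDisc (ρ : ℝ) : Opens (ℂ × ℂ) :=
  ⟨{q : ℂ × ℂ | ‖q.1‖ < ρ}, isOpen_lt (continuous_norm.comp continuous_fst) continuous_const⟩

/-- Membership in the cap disc. -/
@[simp] theorem mem_capDisc {ρ : ℝ} {q : ℂ × ℂ} : q ∈ capDisc ρ ↔ ‖q.1‖ < ρ := Iff.rfl

/-- The involution `(z, w) ↦ (z⁻¹, w)` of `{z ≠ 0} ⊆ ℂ × ℂ` as an open partial homeomorphism. -/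
def invFst : OpenPartialHomeomorph (ℂ × ℂ) (ℂ × ℂ) where
  toFun q := (q.1⁻¹, q.2)
  invFun q := (q.1⁻¹, q.2)
  source := {q | q.1 ≠ 0}
  target := {q | q.1 ≠ 0}
  map_source' q hq := by simpa using hq
  map_target' q hq := by simpa using hq
  left_inv' q _ := by simp
  right_inv' q _ := by simp
  open_source := isOpen_ne_fun continuous_fst continuous_const
  open_target := isOpen_ne_fun continuous_fst continuous_const
  continuousOn_toFun := (continuousOn_fst.inv₀ fun _ hq => hq).prodMk continuousOn_snd
  continuousOn_invFun := (continuousOn_fst.inv₀ fun _ hq => hq).prodMk continuousOn_snd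

/-- `invFst (z, w) = (z⁻¹, w)`. -/
@[simp] theorem invFst_apply (q : ℂ × ℂ) : invFst q = (q.1⁻¹, q.2) := rfl

/-- `invFst.symm (z, w) = (z⁻¹, w)`. -/
@[simp] theorem invFst_symm_apply (q : ℂ × ℂ) : invFst.symm q = (q.1⁻¹, q.2) := rfl

/-- The source of `invFst` is `{z ≠ 0}`. -/
@[simp] theorem invFst_source : invFst.source = {q : ℂ × ℂ | q.1 ≠ 0} := rfl

/-- The target of `invFst` is `{z ≠ 0}`. -/
@[simp] theorem invFst_target : invFst.target = {q : ℂ × ℂ | q.1 ≠ 0} := rfl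

/-- `invFst` is smooth on its source. -/
theorem contDiffOn_invFst : ContDiffOn ℝ ∞ invFst {q : ℂ × ℂ | q.1 ≠ 0} :=
  ((contDiffOn_fst (𝕜 := ℝ)).inv fun _ hq => hq).prodMk contDiffOn_snd

variable {S : HomotopySphere 4} {p : S.carrier} {ε' : ℝ}

/-! ### The flat chart (from `substub_flatChart`) -/

section FlatChart

variable (hε' : 0 < ε')
  (hball : Metric.closedBall (extChartAt (𝓡 4) p p) ε' ⊆ (extChartAt (𝓡 4) p).target)

/-- The flat chart `Φ = Ycoord p` of the punctured `ε'`-chart-ball onto `{ε'⁻¹ < ‖realify q‖}`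
(a choice of the chart of `substub_flatChart`). -/
def flatChart : OpenPartialHomeomorph (punctured p) (ℂ × ℂ) :=
  Classical.choose (substub_flatChart S p ε' hε' hball)

/-- The defining properties of `flatChart`. -/
theorem flatChart_spec :
    (flatChart hε' hball).source = {x | InPuncturedChartBall p ε' x} ∧
    (flatChart hε' hball).target = {q | ε'⁻¹ < ‖realify q‖} ∧
    (∀ x : punctured p, flatChart hε' hball x = Ycoord p x) ∧
    (∀ q ∈ (flatChart hε' hball).target, ((flatChart hε' hball).symm q).1 =
      (extChartAt (𝓡 4) p).symm (extChartAt (𝓡 4) p p + inversion (realify q))) ∧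
    ContMDiffOn (𝓡 4) 𝓘(ℝ, ℂ × ℂ) ∞ (flatChart hε' hball) (flatChart hε' hball).source ∧
    ContMDiffOn 𝓘(ℝ, ℂ × ℂ) (𝓡 4) ∞ (flatChart hε' hball).symm
      (flatChart hε' hball).target ∧
    (∀ x ∈ (flatChart hε' hball).source, ∀ v : TangentSpace (𝓡 4) x,
      realify (mfderiv (𝓡 4) 𝓘(ℝ, ℂ × ℂ) (flatChart hε' hball) x v) =
        fderiv ℝ inversion (extChartAt (𝓡 4) p x.1 - extChartAt (𝓡 4) p p)
          (mfderiv (𝓡 4) 𝓘(ℝ, EuclideanSpace ℝ (Fin 4))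
            (fun z : punctured p => extChartAt (𝓡 4) p z.1) x v)) :=
  Classical.choose_spec (substub_flatChart S p ε' hε' hball)

/-- The source of the flat chart is the punctured `ε'`-chart-ball. -/
theorem flatChart_source :
    (flatChart hε' hball).source = {x | InPuncturedChartBall p ε' x} :=
  (flatChart_spec hε' hball).1

/-- The target of the flat chart is `{ε'⁻¹ < ‖realify q‖}`. -/
theorem flatChart_target :
    (flatChart hε' hball).target = {q | ε'⁻¹ < ‖realify q‖} :=
  (flatChart_spec hε' hball).2.1

/-- The flat chart is `Ycoord p`. -/
theorem flatChart_apply (x : punctured p) : flatChart hε' hball x = Ycoord p x :=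
  (flatChart_spec hε' hball).2.2.1 x

/-- The flat chart is smooth on its source. -/
theorem contMDiffOn_flatChart :
    ContMDiffOn (𝓡 4) 𝓘(ℝ, ℂ × ℂ) ∞ (flatChart hε' hball) (flatChart hε' hball).source :=
  (flatChart_spec hε' hball).2.2.2.2.1

/-- The inverse flat chart is smooth on the target. -/
theorem contMDiffOn_flatChart_symm :
    ContMDiffOn 𝓘(ℝ, ℂ × ℂ) (𝓡 4) ∞ (flatChart hε' hball).symm
      (flatChart hε' hball).target :=
  (flatChart_spec hε' hball).2.2.2.2.2.1

/-- The differential of the flat chart, realified, is `Dψ = Dι ∘ De`. -/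
theorem realify_mfderiv_flatChart {x : punctured p} (hx : x ∈ (flatChart hε' hball).source)
    (v : TangentSpace (𝓡 4) x) :
    realify (mfderiv (𝓡 4) 𝓘(ℝ, ℂ × ℂ) (flatChart hε' hball) x v) =
      fderiv ℝ inversion (extChartAt (𝓡 4) p x.1 - extChartAt (𝓡 4) p p)
        (mfderiv (𝓡 4) 𝓘(ℝ, EuclideanSpace ℝ (Fin 4))
          (fun z : punctured p => extChartAt (𝓡 4) p z.1) x v) :=
  (flatChart_spec hε' hball).2.2.2.2.2.2 x hx v

end FlatChart

/-! ### The gluing map `x ↦ ((z x)⁻¹, w x)` -/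

section Glue

variable (hε' : 0 < ε')
  (hball : Metric.closedBall (extChartAt (𝓡 4) p p) ε' ⊆ (extChartAt (𝓡 4) p).target)

/-- The cap radius `ρ = min (ε'/2) 1` (any `0 < ρ < ε'` would do; `ρ ≤ ε'/2` keeps the gluing
region compactly inside the `ε'`-chart-ball, which makes the graph of the gluing map closed). -/
def capRadius (ε' : ℝ) : ℝ := min (ε' / 2) 1

/-- `0 < ρ`. -/
theorem capRadius_pos (hε' : 0 < ε') : 0 < capRadius ε' := lt_min (by linarith) one_pos

/-- `ρ ≤ ε' / 2`. -/
theorem capRadius_le_half : capRadius ε' ≤ ε' / 2 := min_le_left _ _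

/-- `ρ ≤ ε'`. -/
theorem capRadius_le (hε' : 0 < ε') : capRadius ε' ≤ ε' :=
  capRadius_le_half.trans (by linarith)

/-- The cap disc of radius `ρ` is nonempty (it contains `(0, 0)`). -/
theorem capDisc_nonempty (hε' : 0 < ε') : Nonempty (capDisc (capRadius ε')) :=
  ⟨⟨(0, 0), by simp [capRadius_pos hε']⟩⟩

/-- The inclusion `capDisc ρ → ℂ × ℂ` as an open partial homeomorphism. -/
def capCoe : OpenPartialHomeomorph (capDisc (capRadius ε')) (ℂ × ℂ) :=
  (capDisc (capRadius ε')).openPartialHomeomorphSubtypeCoe (capDisc_nonempty hε')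

/-- `capCoe` is the coercion. -/
@[simp] theorem capCoe_apply (b : capDisc (capRadius ε')) : capCoe hε' b = (b : ℂ × ℂ) := rfl

/-- The source of `capCoe` is everything. -/
@[simp] theorem capCoe_source : (capCoe hε').source = univ := rfl

/-- The target of `capCoe` is the cap disc. -/
@[simp] theorem capCoe_target : (capCoe hε').target = (capDisc (capRadius ε') : Set (ℂ × ℂ)) :=
  Opens.openPartialHomeomorphSubtypeCoe_target _ _

/-- `capCoe.symm q`, coerced back, is `q` for `q` in the cap disc. -/
theorem capCoe_symm_coe {q : ℂ × ℂ} (hq : ‖q.1‖ < capRadius ε') :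
    ((capCoe hε').symm q : ℂ × ℂ) = q := by
  have hq' : q ∈ (capCoe hε').target := by rw [capCoe_target]; exact hq
  exact (capCoe hε').right_inv hq'

/-- `capCoe.symm b = b` for a point of the cap disc. -/
theorem capCoe_symm_apply_coe (b : capDisc (capRadius ε')) :
    (capCoe hε').symm (b : ℂ × ℂ) = b :=
  (capCoe hε').left_inv (by simp)

/-- The gluing map `Σ ∖ p ⇀ capDisc ρ`, `x ↦ ((z x)⁻¹, w x)`: the flat chart followed by `invFst`
and the corestriction to the open cap disc. -/
def capGlue : OpenPartialHomeomorph (punctured p) (capDisc (capRadius ε')) :=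
  ((flatChart hε' hball).trans invFst).trans (capCoe hε').symm

/-- Description of the source of the gluing map: the points of the punctured `ε'`-ball with
`ρ⁻¹ < ‖z‖`. -/
theorem mem_capGlue_source_iff (x : punctured p) :
    x ∈ (capGlue hε' hball).source ↔
      InPuncturedChartBall p ε' x ∧ (capRadius ε')⁻¹ < ‖(Ycoord p x).1‖ := by
  have hρ := capRadius_pos hε'
  rw [capGlue, OpenPartialHomeomorph.trans_source, OpenPartialHomeomorph.trans_source,
    OpenPartialHomeomorph.symm_source, capCoe_target, flatChart_source]
  simp only [mem_inter_iff, mem_preimage, mem_setOf_eq, OpenPartialHomeomorph.coe_trans,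
    comp_apply, invFst_source, invFst_apply, flatChart_apply, SetLike.mem_coe, mem_capDisc,
    norm_inv]
  constructor
  · rintro ⟨⟨hb, hz⟩, hlt⟩
    exact ⟨hb, (inv_lt_comm₀ (norm_pos_iff.2 hz) hρ).1 hlt⟩
  · rintro ⟨hb, hlt⟩
    have hzpos : 0 < ‖(Ycoord p x).1‖ := (inv_pos.2 hρ).trans hlt
    exact ⟨⟨hb, norm_pos_iff.1 hzpos⟩, (inv_lt_comm₀ hzpos hρ).2 hlt⟩

/-- Value of the gluing map (as a point of `ℂ × ℂ`). -/
theorem capGlue_apply_coe (x : punctured p) (hx : x ∈ (capGlue hε' hball).source) :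
    ((capGlue hε' hball x : capDisc (capRadius ε')) : ℂ × ℂ) =
      (((Ycoord p x).1)⁻¹, (Ycoord p x).2) := by
  obtain ⟨_, hlt⟩ := (mem_capGlue_source_iff hε' hball x).1 hx
  have hρ := capRadius_pos hε'
  have hzpos : 0 < ‖(Ycoord p x).1‖ := (inv_pos.2 hρ).trans hlt
  have hq : ‖((((Ycoord p x).1)⁻¹, (Ycoord p x).2) : ℂ × ℂ).1‖ < capRadius ε' := by
    simpa [norm_inv] using (inv_lt_comm₀ hzpos hρ).2 hlt
  simp only [capGlue, OpenPartialHomeomorph.coe_trans, comp_apply, invFst_apply, flatChart_apply]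
  exact capCoe_symm_coe hε' hq

/-- Description of the target of the gluing map: the points of the cap disc off the line `t = 0`. -/
theorem mem_capGlue_target_iff (b : capDisc (capRadius ε')) :
    b ∈ (capGlue hε' hball).target ↔ (b : ℂ × ℂ).1 ≠ 0 := by
  have hρ := capRadius_pos hε'
  rw [capGlue, OpenPartialHomeomorph.trans_target, OpenPartialHomeomorph.trans_target,
    OpenPartialHomeomorph.symm_target, capCoe_source, OpenPartialHomeomorph.symm_symm,
    flatChart_target]
  simp only [univ_inter, mem_preimage, mem_inter_iff, invFst_target, mem_setOf_eq, capCoe_apply,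
    invFst_symm_apply]
  constructor
  · exact fun h => h.1
  · intro h
    refine ⟨h, ?_⟩
    have hb : ‖(b : ℂ × ℂ).1‖ < capRadius ε' := b.2
    have h1 : ε'⁻¹ < ‖((b : ℂ × ℂ).1)⁻¹‖ := by
      rw [norm_inv]
      have : (capRadius ε')⁻¹ < ‖(b : ℂ × ℂ).1‖⁻¹ :=
        (inv_lt_inv₀ hρ (norm_pos_iff.2 h)).2 hb
      exact lt_of_le_of_lt ((inv_le_inv₀ hε' hρ).2 (capRadius_le hε')) this
    exact h1.trans_le (Target.CroftonPencil.norm_fst_le_norm_realify ((((b : ℂ × ℂ).1)⁻¹, (b : ℂ × ℂ).2) : ℂ × ℂ))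

/-- The inverse gluing map: `glue.symm b = Φ.symm ((b.1)⁻¹, b.2)`. -/
theorem capGlue_symm_apply (b : capDisc (capRadius ε')) :
    (capGlue hε' hball).symm b = (flatChart hε' hball).symm (((b : ℂ × ℂ).1)⁻¹, (b : ℂ × ℂ).2) := by
  simp only [capGlue, OpenPartialHomeomorph.trans_symm_eq_symm_trans_symm,
    OpenPartialHomeomorph.symm_symm, OpenPartialHomeomorph.coe_trans, comp_apply, capCoe_apply,
    invFst_symm_apply]

/-- The gluing map is smooth on its source. -/
theorem contMDiffOn_capGlue :
    ContMDiffOn (𝓡 4) 𝓘(ℝ, ℂ × ℂ) ∞ (capGlue hε' hball) (capGlue hε' hball).source := by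
  intro x hx
  rw [← ContMDiffWithinAt.subtypeVal_comp_iff]
  have hsrc : (capGlue hε' hball).source ⊆ (flatChart hε' hball).source := by
    intro y hy
    rw [flatChart_source]
    exact ((mem_capGlue_source_iff hε' hball y).1 hy).1
  have h1 : ContMDiffOn (𝓡 4) 𝓘(ℝ, ℂ × ℂ) ∞ (invFst ∘ flatChart hε' hball)
      (capGlue hε' hball).source := by
    refine (contDiffOn_invFst.contMDiffOn).comp ((contMDiffOn_flatChart hε' hball).mono hsrc) ?_
    intro y hy
    obtain ⟨_, hlt⟩ := (mem_capGlue_source_iff hε' hball y).1 hy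
    show (flatChart hε' hball y).1 ≠ 0
    rw [flatChart_apply]
    exact norm_pos_iff.1 ((inv_pos.2 (capRadius_pos hε')).trans hlt)
  refine (h1 x hx).congr (fun y hy => ?_) ?_
  · rw [comp_apply, capGlue_apply_coe hε' hball y hy, comp_apply, invFst_apply, flatChart_apply]
  · rw [comp_apply, capGlue_apply_coe hε' hball x hx, comp_apply, invFst_apply, flatChart_apply]

/-- The inverse gluing map is smooth on the target. -/
theorem contMDiffOn_capGlue_symm :
    ContMDiffOn 𝓘(ℝ, ℂ × ℂ) (𝓡 4) ∞ (capGlue hε' hball).symm (capGlue hε' hball).target := by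
  have hval : ContMDiff 𝓘(ℝ, ℂ × ℂ) 𝓘(ℝ, ℂ × ℂ) ∞
      (Subtype.val : capDisc (capRadius ε') → ℂ × ℂ) := contMDiff_subtype_val
  have h1 : ContMDiffOn 𝓘(ℝ, ℂ × ℂ) 𝓘(ℝ, ℂ × ℂ) ∞
      (invFst ∘ (Subtype.val : capDisc (capRadius ε') → ℂ × ℂ)) (capGlue hε' hball).target := by
    refine (contDiffOn_invFst.contMDiffOn).comp hval.contMDiffOn ?_
    intro b hb
    exact (mem_capGlue_target_iff hε' hball b).1 hb
  have h2 : ContMDiffOn 𝓘(ℝ, ℂ × ℂ) (𝓡 4) ∞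
      ((flatChart hε' hball).symm ∘ (invFst ∘ (Subtype.val : capDisc (capRadius ε') → ℂ × ℂ)))
      (capGlue hε' hball).target := by
    refine (contMDiffOn_flatChart_symm hε' hball).comp h1 ?_
    intro b hb
    have hb' := hb
    rw [capGlue, OpenPartialHomeomorph.trans_target, OpenPartialHomeomorph.trans_target] at hb'
    simpa using hb'.2.2
  refine h2.congr fun b _ => ?_
  simp only [comp_apply, capGlue_symm_apply, invFst_apply]

/-- **The gluing datum of the one-chart end cap**: `Σ ∖ p` and the cap disc glued along
`x ↦ ((z x)⁻¹, w x)`; model spaces `ℝ⁴` (identity) and `ℂ × ℂ` (realification `flatCx.symm`). -/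
def capGlueData : SmoothGlueData (𝓡 4) 𝓘(ℝ, ℂ × ℂ) (punctured p) (capDisc (capRadius ε'))
    (EuclideanSpace ℝ (Fin 4)) where
  glue := capGlue hε' hball
  contMDiffOn_glue := contMDiffOn_capGlue hε' hball
  contMDiffOn_glue_symm := contMDiffOn_capGlue_symm hε' hball
  linA := ContinuousLinearEquiv.refl ℝ _
  linB := flatCx.symm

/-- The gluing map of `capGlueData` is `capGlue`. -/
@[simp] theorem capGlueData_glue : (capGlueData hε' hball).glue = capGlue hε' hball := rfl

/-- `linA = id`. -/
@[simp] theorem capGlueData_linA :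
    (capGlueData hε' hball).linA = ContinuousLinearEquiv.refl ℝ (EuclideanSpace ℝ (Fin 4)) := rfl

/-- `linB = flatCx.symm`. -/
@[simp] theorem capGlueData_linB : (capGlueData hε' hball).linB = flatCx.symm := rfl

/-- The cap disc set `{(t, σ) | ‖t‖ < ρ}` is open in `ℂ × ℂ`. Registered helper of the crux
(stub `stub_capModel`, file I). -/
theorem helper_capModel_isOpen_capDiscSet :
    ∀ ρ : ℝ, IsOpen {q : ℂ × ℂ | ‖q.1‖ < ρ} :=
  fun _ => isOpen_lt (continuous_norm.comp continuous_fst) continuous_const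

end Glue

end Summit.SmoothPoincare4.SmoothPoincare4.Theorems.WitnessCharge.PencilIncompleteness
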